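import Mathlib
import Summits.Ventures.PercRepro2.HCov
import Summits.Ventures.PercRepro2.HCovCubic
import Summits.Ventures.PercRepro2.TriDisagreement
import Summits.Ventures.PercRepro2.TriDisagreementPinned
import Summits.Ventures.PercRepro2.TypedSplit
import Summits.Ventures.PercRepro2.OneTypedEdge
import Summits.Ventures.PercRepro2.TypedSeries
import Summits.Ventures.PercRepro2.StarPattern
import Summits.Ventures.PercRepro2.StarIdentities
import Summits.Ventures.PercRepro2.StarDebt
import Summits.Ventures.PercRepro2.StarPairs
import Summits.Ventures.PercRepro2.StarPairsTwo

/-!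
# The nested leaf of a `(2,1,2)` star is a signed combination of typed counts of the graph (blind
cell PercRepro2, p1 g12; the graph-row reading of NPM after NEG-108)

The debt identity `star_212` reads, with the pair bases replaced by the typed counts of `G` they
are (`StarPairs.lean`, `StarPairsTwo.lean`):

`N_(2,1,2)(G) = E(T; 02) + N(G; s₁ open, s₂ s₃ type 1) + N(G; s₃ open, s₁ type 2) +
  N(G; s₃ open, s₁ s₂ type 1)`

(**`star_212_graph`**; `E(T; 02) = B(02₁, T₁) − B(T₁)` is the exclusive nested leaf). Hence the
nested-pair monotonicity NPM at this star — `B(T₁) ≤ B(02₁, T₁)`, the one-rung object of the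
`(2,1,2)` hard step — is an inequality INSIDE the graph row: the typed count of `G` with all three
star edges typed dominates the three typed counts with one star edge pinned open
(**`npm_02_iff_graph`**; the `(1,2,2)` orientation: `star_122_graph`, `npm_12_iff_graph`; the `(2,2,1)`
one: `StarDebt221.lean`). Likewise the triple base is a signed combination of typed counts of `G`:
`B(T₁) = N_(1,1,1)(G) − 2 Σ_p N(G; p) − 6 N(G − y)` (**`Bone_T_eq_graph`**, from `star_111`;
`Bempty_eq_typedCount`). No hyperedge and no positivity claim; identities and an equivalence.
-/

namespace Summit.Ventures.PercRepro2

open CovForm CovForm.OneTyped CovForm.TypedRed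

namespace StarPattern

section Graph

variable {V : Type*} {E : Type*} [Fintype E] [DecidableEq E] {R : Type*} [Field R]
  {ends : E → Sym2 V} {o a₁ a₂ a₃ b : V} {s₁ s₂ s₃ : E} {y u₁ u₂ u₃ : V}

/-- **The `(2,1,2)` star in typed counts of the graph**: `N_(2,1,2) = E(T;02) + N(s₁ open; s₂, s₃ of
type 1) + N(s₃ open; s₁ of type 2) + N(s₃ open; s₁, s₂ of type 1)`. -/
theorem star_212_graph (F : Finset E) (z : Config E) (τ : E → ℕ)
    (D : StarData ends o a₁ a₂ a₃ b s₁ s₂ s₃ y u₁ u₂ u₃ (((F.erase s₁).erase s₂).erase s₃)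
      (Function.update (Function.update (Function.update z s₁ false) s₂ false) s₃ false))
    (hs₁ : s₁ ∈ F) (hs₂ : s₂ ∈ F) (hs₃ : s₃ ∈ F) (hτ₁ : τ s₁ = 2) (hτ₂ : τ s₂ = 1)
    (hτ₃ : τ s₃ = 2) :
    typedCount F z τ (K3 ends o a₁ a₂ a₃ b : Config E → Config E → Config E → R) =
      (Btwo ends o a₁ a₂ a₃ b s₁ s₂ s₃ (((F.erase s₁).erase s₂).erase s₃)
        (Function.update (Function.update (Function.update z s₁ false) s₂ false) s₃ false) τ
        (true, false, true) (true, true, true) -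
      Bone ends o a₁ a₂ a₃ b s₁ s₂ s₃ (((F.erase s₁).erase s₂).erase s₃)
        (Function.update (Function.update (Function.update z s₁ false) s₂ false) s₃ false) τ
        (true, true, true)) +
      typedCount (insert s₂ (insert s₃ (((F.erase s₁).erase s₂).erase s₃)))
        (Function.update (Function.update (Function.update (Function.update z s₁ false) s₂ false)
          s₃ false) s₁ true)
        (Function.update (Function.update τ s₃ 1) s₂ 1) (K3 ends o a₁ a₂ a₃ b) +
      typedCount (insert s₁ (((F.erase s₁).erase s₂).erase s₃))
        (Function.update (Function.update (Function.update (Function.update z s₁ false) s₂ false)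
          s₃ false) s₃ true)
        (Function.update τ s₁ 2) (K3 ends o a₁ a₂ a₃ b) +
      typedCount (insert s₁ (insert s₂ (((F.erase s₁).erase s₂).erase s₃)))
        (Function.update (Function.update (Function.update (Function.update z s₁ false) s₂ false)
          s₃ false) s₃ true)
        (Function.update (Function.update τ s₂ 1) s₁ 1) (K3 ends o a₁ a₂ a₃ b) := by
  have hz₁ : Function.update (Function.update (Function.update z s₁ false) s₂ false) s₃ false s₁ =
      false := by
    rw [Function.update_of_ne D.h13, Function.update_of_ne D.h12, Function.update_self]
  have hz₂ : Function.update (Function.update (Function.update z s₁ false) s₂ false) s₃ false s₂ =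
      false := by
    rw [Function.update_of_ne D.h23, Function.update_self]
  have hz₃ : Function.update (Function.update (Function.update z s₁ false) s₂ false) s₃ false s₃ =
      false := Function.update_self _ _ _
  have h := star_212 (R := R) F z τ D hs₁ hs₂ hs₃ hτ₁ hτ₂ hτ₃
  rw [Btwo_01_02_eq_typedCount D τ hz₁ hz₂ hz₃, Btype2_02_eq_typedCount D τ hz₁ hz₂ hz₃,
    Btwo_02_12_eq_typedCount D τ hz₁ hz₂ hz₃]
  linear_combination h

/-- **The `(1,2,2)` star in typed counts of the graph**: `N_(1,2,2) = E(T;12) + N(s₂ open; s₁, s₃ of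
type 1) + N(s₃ open; s₁, s₂ of type 1) + N(s₃ open; s₂ of type 2)`. -/
theorem star_122_graph (F : Finset E) (z : Config E) (τ : E → ℕ)
    (D : StarData ends o a₁ a₂ a₃ b s₁ s₂ s₃ y u₁ u₂ u₃ (((F.erase s₁).erase s₂).erase s₃)
      (Function.update (Function.update (Function.update z s₁ false) s₂ false) s₃ false))
    (hs₁ : s₁ ∈ F) (hs₂ : s₂ ∈ F) (hs₃ : s₃ ∈ F) (hτ₁ : τ s₁ = 1) (hτ₂ : τ s₂ = 2)
    (hτ₃ : τ s₃ = 2) :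
    typedCount F z τ (K3 ends o a₁ a₂ a₃ b : Config E → Config E → Config E → R) =
      (Btwo ends o a₁ a₂ a₃ b s₁ s₂ s₃ (((F.erase s₁).erase s₂).erase s₃)
        (Function.update (Function.update (Function.update z s₁ false) s₂ false) s₃ false) τ
        (false, true, true) (true, true, true) -
      Bone ends o a₁ a₂ a₃ b s₁ s₂ s₃ (((F.erase s₁).erase s₂).erase s₃)
        (Function.update (Function.update (Function.update z s₁ false) s₂ false) s₃ false) τ
        (true, true, true)) +
      typedCount (insert s₁ (insert s₃ (((F.erase s₁).erase s₂).erase s₃)))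
        (Function.update (Function.update (Function.update (Function.update z s₁ false) s₂ false)
          s₃ false) s₂ true)
        (Function.update (Function.update τ s₃ 1) s₁ 1) (K3 ends o a₁ a₂ a₃ b) +
      typedCount (insert s₁ (insert s₂ (((F.erase s₁).erase s₂).erase s₃)))
        (Function.update (Function.update (Function.update (Function.update z s₁ false) s₂ false)
          s₃ false) s₃ true)
        (Function.update (Function.update τ s₂ 1) s₁ 1) (K3 ends o a₁ a₂ a₃ b) +
      typedCount (insert s₂ (((F.erase s₁).erase s₂).erase s₃))
        (Function.update (Function.update (Function.update (Function.update z s₁ false) s₂ false)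
          s₃ false) s₃ true)
        (Function.update τ s₂ 2) (K3 ends o a₁ a₂ a₃ b) := by
  have hz₁ : Function.update (Function.update (Function.update z s₁ false) s₂ false) s₃ false s₁ =
      false := by
    rw [Function.update_of_ne D.h13, Function.update_of_ne D.h12, Function.update_self]
  have hz₂ : Function.update (Function.update (Function.update z s₁ false) s₂ false) s₃ false s₂ =
      false := by
    rw [Function.update_of_ne D.h23, Function.update_self]
  have hz₃ : Function.update (Function.update (Function.update z s₁ false) s₂ false) s₃ false s₃ =
      false := Function.update_self _ _ _
  have h := star_122 (R := R) F z τ D hs₁ hs₂ hs₃ hτ₁ hτ₂ hτ₃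
  rw [Btwo_01_12_eq_typedCount D τ hz₁ hz₂ hz₃, Btwo_02_12_eq_typedCount D τ hz₁ hz₂ hz₃,
    Btype2_12_eq_typedCount D τ hz₁ hz₂ hz₃]
  linear_combination h

end Graph

section Triple

variable {V : Type*} {E : Type*} [Fintype E] [DecidableEq E] {R : Type*} [Field R]
  {ends : E → Sym2 V} {o a₁ a₂ a₃ b : V} {s₁ s₂ s₃ : E} {y u₁ u₂ u₃ : V}

omit [Fintype E] in
/-- On a configuration with the star closed, setting the star to `∅` changes nothing. -/
lemma starSet_empty_of_closed (h12 : s₁ ≠ s₂) (h13 : s₁ ≠ s₃) (h23 : s₂ ≠ s₃) {x : Config E}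
    (hx₁ : x s₁ = false) (hx₂ : x s₂ = false) (hx₃ : x s₃ = false) :
    starSet s₁ s₂ s₃ (false, false, false) x = x := by
  funext g
  rw [starSet_apply h12 h13 h23]
  split_ifs <;> simp_all

/-- **The closed-star base is the typed count of `G − y`** (the star pinned closed). -/
theorem Bempty_eq_typedCount {F₀ : Finset E} {z₀ : Config E}
    (D : StarData ends o a₁ a₂ a₃ b s₁ s₂ s₃ y u₁ u₂ u₃ F₀ z₀) (τ : E → ℕ) (hz₁ : z₀ s₁ = false)
    (hz₂ : z₀ s₂ = false) (hz₃ : z₀ s₃ = false) :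
    Bempty (R := R) ends o a₁ a₂ a₃ b s₁ s₂ s₃ F₀ z₀ τ =
      typedCount F₀ z₀ τ (K3 ends o a₁ a₂ a₃ b) := by
  unfold Bempty patCount patKernel
  refine typedCount_congr_on F₀ z₀ τ fun x y w hpin _ => ?_
  rw [starSet_empty_of_closed D.h12 D.h13 D.h23 ((hpin s₁ D.hF₁).1.trans hz₁)
      ((hpin s₂ D.hF₂).1.trans hz₂) ((hpin s₃ D.hF₃).1.trans hz₃),
    starSet_empty_of_closed D.h12 D.h13 D.h23 ((hpin s₁ D.hF₁).2.1.trans hz₁)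
      ((hpin s₂ D.hF₂).2.1.trans hz₂) ((hpin s₃ D.hF₃).2.1.trans hz₃),
    starSet_empty_of_closed D.h12 D.h13 D.h23 ((hpin s₁ D.hF₁).2.2.trans hz₁)
      ((hpin s₂ D.hF₂).2.2.trans hz₂) ((hpin s₃ D.hF₃).2.2.trans hz₃)]

/-- **The triple base `B(T₁)` is a signed combination of typed counts of the graph**:
`B(T₁) = N_(1,1,1)(G) − 2 Σ_p N(G; p) − 6 N(G − y)` with `N(G; p)` the pair base as the typed count
with one star edge pinned open (`star_111` read with `StarPairs.lean`). -/
theorem Bone_T_eq_graph (F : Finset E) (z : Config E) (τ : E → ℕ)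
    (D : StarData ends o a₁ a₂ a₃ b s₁ s₂ s₃ y u₁ u₂ u₃ (((F.erase s₁).erase s₂).erase s₃)
      (Function.update (Function.update (Function.update z s₁ false) s₂ false) s₃ false))
    (hs₁ : s₁ ∈ F) (hs₂ : s₂ ∈ F) (hs₃ : s₃ ∈ F) (hτ₁ : τ s₁ = 1) (hτ₂ : τ s₂ = 1)
    (hτ₃ : τ s₃ = 1) :
    Bone (R := R) ends o a₁ a₂ a₃ b s₁ s₂ s₃ (((F.erase s₁).erase s₂).erase s₃)
        (Function.update (Function.update (Function.update z s₁ false) s₂ false) s₃ false) τ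
        (true, true, true) =
      typedCount F z τ (K3 ends o a₁ a₂ a₃ b) -
      2 * (typedCount (insert s₁ (((F.erase s₁).erase s₂).erase s₃))
          (Function.update (Function.update (Function.update (Function.update z s₁ false) s₂ false)
            s₃ false) s₂ true) (Function.update τ s₁ 1) (K3 ends o a₁ a₂ a₃ b) +
        typedCount (insert s₁ (((F.erase s₁).erase s₂).erase s₃))
          (Function.update (Function.update (Function.update (Function.update z s₁ false) s₂ false)
            s₃ false) s₃ true) (Function.update τ s₁ 1) (K3 ends o a₁ a₂ a₃ b) +
        typedCount (insert s₂ (((F.erase s₁).erase s₂).erase s₃))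
          (Function.update (Function.update (Function.update (Function.update z s₁ false) s₂ false)
            s₃ false) s₃ true) (Function.update τ s₂ 1) (K3 ends o a₁ a₂ a₃ b)) -
      6 * typedCount (((F.erase s₁).erase s₂).erase s₃)
        (Function.update (Function.update (Function.update z s₁ false) s₂ false) s₃ false) τ
        (K3 ends o a₁ a₂ a₃ b) := by
  have hz₁ : Function.update (Function.update (Function.update z s₁ false) s₂ false) s₃ false s₁ =
      false := by
    rw [Function.update_of_ne D.h13, Function.update_of_ne D.h12, Function.update_self]
  have hz₂ : Function.update (Function.update (Function.update z s₁ false) s₂ false) s₃ false s₂ =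
      false := by
    rw [Function.update_of_ne D.h23, Function.update_self]
  have hz₃ : Function.update (Function.update (Function.update z s₁ false) s₂ false) s₃ false s₃ =
      false := Function.update_self _ _ _
  have h := star_111 (R := R) F z τ D hs₁ hs₂ hs₃ hτ₁ hτ₂ hτ₃
  rw [Bone_01_eq_typedCount D τ hz₁ hz₂ hz₃, Bone_02_eq_typedCount D τ hz₁ hz₂ hz₃,
    Bone_12_eq_typedCount D τ hz₁ hz₂ hz₃, ← Bempty_eq_typedCount D τ hz₁ hz₂ hz₃]
  linear_combination -h

end Triple

section NPM

variable {V : Type*} {E : Type*} [Fintype E] [DecidableEq E] {R : Type*} [Field R] [LinearOrder R]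
  [IsStrictOrderedRing R] {ends : E → Sym2 V} {o a₁ a₂ a₃ b : V} {s₁ s₂ s₃ : E} {y u₁ u₂ u₃ : V}

/-- **NPM at a `(2,1,2)` star is an inequality inside the graph row**: `B(T₁) ≤ B(02₁, T₁)` iff
`N(s₁ open; s₂ s₃ type 1) + N(s₃ open; s₁ type 2) + N(s₃ open; s₁ s₂ type 1) ≤ N_(2,1,2)(G)`. -/
theorem npm_02_iff_graph (F : Finset E) (z : Config E) (τ : E → ℕ)
    (D : StarData ends o a₁ a₂ a₃ b s₁ s₂ s₃ y u₁ u₂ u₃ (((F.erase s₁).erase s₂).erase s₃)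
      (Function.update (Function.update (Function.update z s₁ false) s₂ false) s₃ false))
    (hs₁ : s₁ ∈ F) (hs₂ : s₂ ∈ F) (hs₃ : s₃ ∈ F) (hτ₁ : τ s₁ = 2) (hτ₂ : τ s₂ = 1)
    (hτ₃ : τ s₃ = 2) :
    Bone (R := R) ends o a₁ a₂ a₃ b s₁ s₂ s₃ (((F.erase s₁).erase s₂).erase s₃)
        (Function.update (Function.update (Function.update z s₁ false) s₂ false) s₃ false) τ
        (true, true, true) ≤
      Btwo ends o a₁ a₂ a₃ b s₁ s₂ s₃ (((F.erase s₁).erase s₂).erase s₃)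
        (Function.update (Function.update (Function.update z s₁ false) s₂ false) s₃ false) τ
        (true, false, true) (true, true, true) ↔
    typedCount (insert s₂ (insert s₃ (((F.erase s₁).erase s₂).erase s₃)))
        (Function.update (Function.update (Function.update (Function.update z s₁ false) s₂ false)
          s₃ false) s₁ true)
        (Function.update (Function.update τ s₃ 1) s₂ 1)
        (K3 ends o a₁ a₂ a₃ b : Config E → Config E → Config E → R) +
      typedCount (insert s₁ (((F.erase s₁).erase s₂).erase s₃))
        (Function.update (Function.update (Function.update (Function.update z s₁ false) s₂ false)
          s₃ false) s₃ true)
        (Function.update τ s₁ 2) (K3 ends o a₁ a₂ a₃ b) +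
      typedCount (insert s₁ (insert s₂ (((F.erase s₁).erase s₂).erase s₃)))
        (Function.update (Function.update (Function.update (Function.update z s₁ false) s₂ false)
          s₃ false) s₃ true)
        (Function.update (Function.update τ s₂ 1) s₁ 1) (K3 ends o a₁ a₂ a₃ b) ≤
      typedCount F z τ (K3 ends o a₁ a₂ a₃ b) := by
  have h := star_212_graph (R := R) F z τ D hs₁ hs₂ hs₃ hτ₁ hτ₂ hτ₃
  constructor
  · intro h1; linarith
  · intro h1; linarith

/-- **NPM at a `(1,2,2)` star is an inequality inside the graph row**: `B(T₁) ≤ B(12₁, T₁)` iff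
`N(s₂ open; s₁ s₃ type 1) + N(s₃ open; s₁ s₂ type 1) + N(s₃ open; s₂ type 2) ≤ N_(1,2,2)(G)`. -/
theorem npm_12_iff_graph (F : Finset E) (z : Config E) (τ : E → ℕ)
    (D : StarData ends o a₁ a₂ a₃ b s₁ s₂ s₃ y u₁ u₂ u₃ (((F.erase s₁).erase s₂).erase s₃)
      (Function.update (Function.update (Function.update z s₁ false) s₂ false) s₃ false))
    (hs₁ : s₁ ∈ F) (hs₂ : s₂ ∈ F) (hs₃ : s₃ ∈ F) (hτ₁ : τ s₁ = 1) (hτ₂ : τ s₂ = 2)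
    (hτ₃ : τ s₃ = 2) :
    Bone (R := R) ends o a₁ a₂ a₃ b s₁ s₂ s₃ (((F.erase s₁).erase s₂).erase s₃)
        (Function.update (Function.update (Function.update z s₁ false) s₂ false) s₃ false) τ
        (true, true, true) ≤
      Btwo ends o a₁ a₂ a₃ b s₁ s₂ s₃ (((F.erase s₁).erase s₂).erase s₃)
        (Function.update (Function.update (Function.update z s₁ false) s₂ false) s₃ false) τ
        (false, true, true) (true, true, true) ↔
    typedCount (insert s₁ (insert s₃ (((F.erase s₁).erase s₂).erase s₃)))
        (Function.update (Function.update (Function.update (Function.update z s₁ false) s₂ false)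
          s₃ false) s₂ true)
        (Function.update (Function.update τ s₃ 1) s₁ 1)
        (K3 ends o a₁ a₂ a₃ b : Config E → Config E → Config E → R) +
      typedCount (insert s₁ (insert s₂ (((F.erase s₁).erase s₂).erase s₃)))
        (Function.update (Function.update (Function.update (Function.update z s₁ false) s₂ false)
          s₃ false) s₃ true)
        (Function.update (Function.update τ s₂ 1) s₁ 1) (K3 ends o a₁ a₂ a₃ b) +
      typedCount (insert s₂ (((F.erase s₁).erase s₂).erase s₃))
        (Function.update (Function.update (Function.update (Function.update z s₁ false) s₂ false)
          s₃ false) s₃ true)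
        (Function.update τ s₂ 2) (K3 ends o a₁ a₂ a₃ b) ≤
      typedCount F z τ (K3 ends o a₁ a₂ a₃ b) := by
  have h := star_122_graph (R := R) F z τ D hs₁ hs₂ hs₃ hτ₁ hτ₂ hτ₃
  constructor
  · intro h1; linarith
  · intro h1; linarith

end NPM

end StarPattern

end Summit.Ventures.PercRepro2
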